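import Mathlib
import Summits.Ventures.PercRepro2.K5HyperB

/-!
# THE `M` CERTIFICATES OF THE (i) SIDE AT the coincidence `o = b` (marking `b = 0`), PART 3
(blind cell PercRepro2, typer-1 g12; mine-1 §23.1 / §23.5 at the coincidence markings of `K₅`; twin `k5hyper_b_twin.py i 0`,
kit job j246854)

One `decide +kernel` per comparison under `maxHeartbeats 0` (the g10 rules: bit tables, import-light certificate files).
-/

namespace Summit.Ventures.PercRepro2

namespace K5

set_option maxRecDepth 100000 in
set_option maxHeartbeats 0 in
/-- `M-(i) ≥ 0` at the marking `b = 0` on the triangle `T = {0, 2, 4}`, pair `e = {0, 2}`. -/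
theorem cert_MIB0_024_02 :
    CertLE (kNegMIB 0 (triMask 0 2 4) (pairMask 0 2))
      (kPosMIB 0 (triMask 0 2 4) (pairMask 0 2)) := by
  unfold CertLE
  decide +kernel

set_option maxRecDepth 100000 in
set_option maxHeartbeats 0 in
/-- `M-(i) ≥ 0` at the marking `b = 0` on the triangle `T = {0, 2, 4}`, pair `e = {0, 4}`. -/
theorem cert_MIB0_024_04 :
    CertLE (kNegMIB 0 (triMask 0 2 4) (pairMask 0 4))
      (kPosMIB 0 (triMask 0 2 4) (pairMask 0 4)) := by
  unfold CertLE
  decide +kernel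

set_option maxRecDepth 100000 in
set_option maxHeartbeats 0 in
/-- `M-(i) ≥ 0` at the marking `b = 0` on the triangle `T = {0, 2, 4}`, pair `e = {2, 4}`. -/
theorem cert_MIB0_024_24 :
    CertLE (kNegMIB 0 (triMask 0 2 4) (pairMask 2 4))
      (kPosMIB 0 (triMask 0 2 4) (pairMask 2 4)) := by
  unfold CertLE
  decide +kernel

set_option maxRecDepth 100000 in
set_option maxHeartbeats 0 in
/-- `M-(i) ≥ 0` at the marking `b = 0` on the triangle `T = {0, 3, 4}`, pair `e = {0, 3}`. -/
theorem cert_MIB0_034_03 :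
    CertLE (kNegMIB 0 (triMask 0 3 4) (pairMask 0 3))
      (kPosMIB 0 (triMask 0 3 4) (pairMask 0 3)) := by
  unfold CertLE
  decide +kernel

set_option maxRecDepth 100000 in
set_option maxHeartbeats 0 in
/-- `M-(i) ≥ 0` at the marking `b = 0` on the triangle `T = {0, 3, 4}`, pair `e = {0, 4}`. -/
theorem cert_MIB0_034_04 :
    CertLE (kNegMIB 0 (triMask 0 3 4) (pairMask 0 4))
      (kPosMIB 0 (triMask 0 3 4) (pairMask 0 4)) := by
  unfold CertLE
  decide +kernel

set_option maxRecDepth 100000 in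
set_option maxHeartbeats 0 in
/-- `M-(i) ≥ 0` at the marking `b = 0` on the triangle `T = {0, 3, 4}`, pair `e = {3, 4}`. -/
theorem cert_MIB0_034_34 :
    CertLE (kNegMIB 0 (triMask 0 3 4) (pairMask 3 4))
      (kPosMIB 0 (triMask 0 3 4) (pairMask 3 4)) := by
  unfold CertLE
  decide +kernel

end K5

end Summit.Ventures.PercRepro2
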